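import Summits.KontsevichZagierPeriods.KontsevichZagierPeriods.Theorems.RootDecompWalshStrataEulerDescent02
import Summits.KontsevichZagierPeriods.KontsevichZagierPeriods.Theorems.RootDecompWalshStrataPlanarSections02

/-!
# Affine descent on adapted atoms: `AffineDescent₂ K a b c` for every quadric normal form `K`

Gen 7 of the decomposition node `WalshStrata` (route `RootDecompWalshStrata`, support item
`QuadricBakerDescent` stmt-KontsevichZagierPeriods-27597, slice `d = 3`).  The typed companion target
of the lens file §21, `AffineDescent₂ K a b c` — every two-dimensional representation `[atom, a + b x + c y]`
on an atom of the adapted sign algebra of a quadric normal form `K : Quadric₃` lies in the Baker sector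
modulo KZ's rules (1)–(3) — is PROVED for ALL `K a b c` (`affineDescent₂_holds`; it is the second
hypothesis of the typed glue `QuadricThreeReduction`).  Proof: the planar-sections engine
(`InBaker.of_planar_sections`, part `PlanarSections`) with the potential `Φ(x,y) = (a + b x) y + (c/2) y²`
reduces `[atom, ∂Φ/∂y]` to section terms `[S, Φ(x, ζ x)]` with graph `ζ ⊆ frontier(atom)`; a degenerate
atom (an adapted function vanishing identically with non-zero prescribed sign, or prescribed sign `0` of
a non-trivial adapted function) is empty or null; otherwise the atom is OPEN and its frontier lies in
the square's edges and the zero sets of the non-trivial adapted functions, each of which is a CONIC in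
the fibre variable (`Quadric₃.conic`), so `ζ` is a root `(−B ± √D)/(2A)` (or `−C/B`), and
`Φ(x, ζ x) = P₁(x) ± N(x)·√(e x² + f x + g)` with `deg N ≤ 1` (`Conic.root_value`) — in the Baker sector
by the landed one-variable terminals `InBaker.odd_factor`, `InBaker.linear_factor` (Euler descent 2/12)
and `sqrtDescent_holds` (conic descent 7/7) (`InBaker.affine_sqrt`, `InBaker.conic_section`).
[KontsevichZagier2001 §1.2; BCR1998 §2.2; this node gen 4–6]

This is part 1/2 (§26.1–26.2, namespace `…ConicDescent`: the one-variable terminal `InBaker.affine_sqrt`, the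
root value identity and the conic section lemma `InBaker.conic_section`); the adapted conics of a quadric
normal form, the potential `affΦ`, the typed target `AffineDescent₂` and its proof are part 2/2
(`RootDecompWalshStrataAffineDescent02`, namespace `…ConicDescent.BallCube`).
-/

noncomputable section

open Literature.NumberTheory.Transcendental
open MeasureTheory Set
open MvPolynomial (aeval X C)
open Literature.ModelTheory.ExponentialFields (IsSemialgebraic isSemialgebraic_univ
  isSemialgebraic_setOf_eval_pos isSemialgebraic_setOf_eval_lt isSemialgebraic_setOf_eval_le
  isSemialgebraic_setOf_eval_nonneg isSemialgebraic_setOf_eval_eq_zero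
  isSemialgebraic_setOf_eval_ne_zero continuous_aeval_real tarski_seidenberg_real_holds)

namespace Summit.KontsevichZagierPeriods.RootDecompWalshStrata.ConicDescent

/-! #### 26.1 One-variable terminal: `(n₀ + n₁ x)·√(e x² + f x + g)` over subsets of `[0, 1]` -/

/-- On `[0,1]`: `|√(e x² + f x + g)| ≤ √(|e| + |f| + |g|)`. [folklore] -/
theorem abs_sqrt_qD_le (e f g : ℚ) {x : ℝ} (hx0 : 0 ≤ x) (hx1 : x ≤ 1) :
    |√(qD e f g x)| ≤ √(|(e : ℝ)| + |(f : ℝ)| + |(g : ℝ)|) := by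
  rw [abs_of_nonneg (Real.sqrt_nonneg _)]
  refine Real.sqrt_le_sqrt ?_
  have hx2 : x ^ 2 ≤ 1 := by nlinarith
  have h1 : (e : ℝ) * x ^ 2 ≤ |(e : ℝ)| :=
    calc (e : ℝ) * x ^ 2 ≤ |(e : ℝ)| * x ^ 2 := mul_le_mul_of_nonneg_right (le_abs_self _) (sq_nonneg x)
      _ ≤ |(e : ℝ)| * 1 := mul_le_mul_of_nonneg_left hx2 (abs_nonneg _)
      _ = |(e : ℝ)| := mul_one _
  have h2 : (f : ℝ) * x ≤ |(f : ℝ)| :=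
    calc (f : ℝ) * x ≤ |(f : ℝ)| * x := mul_le_mul_of_nonneg_right (le_abs_self _) hx0
      _ ≤ |(f : ℝ)| * 1 := mul_le_mul_of_nonneg_left hx1 (abs_nonneg _)
      _ = |(f : ℝ)| := mul_one _
  have h3 : (g : ℝ) ≤ |(g : ℝ)| := le_abs_self _
  simp only [qD]; linarith

/-- **AFFINE × SQUARE ROOT TERMINAL.**  `[T, (n₀ + n₁ x)·√(e x² + f x + g)]`, `T ⊆ [0,1]`
`ℚ`-semialgebraic, lies in the Baker sector: `e ≠ 0` — `n₁ (x − x₀)√D` by `InBaker.odd_factor` plus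
`(n₀ + n₁ x₀)√D` by `sqrtDescent_holds`; `e = 0 ≠ f` — `InBaker.linear_factor`; `e = f = 0` —
`n₀ √g` and `n₁ x √g = n₁ √(g x²)` (`x ≥ 0`) by `sqrtDescent_holds`. [this node gen 4–6] -/
theorem InBaker.affine_sqrt (e f g n0 n1 : ℚ) (r : KZ.IntegralRep 1) (hI : r.domain ⊆ Icc 0 1)
    (hr : EqOn r.integrand (fun v => ((n0 : ℝ) + n1 * v 0) * √(qD e f g (v 0))) r.domain) :
    InBaker (KZ.of r) := by
  have hb : Bornology.IsBounded r.domain := (Metric.isBounded_Icc (0 : Fin 1 → ℝ) 1).subset hI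
  have hx : ∀ v ∈ r.domain, 0 ≤ v 0 ∧ v 0 ≤ 1 := fun v hv => ⟨(hI hv).1 0, (hI hv).2 0⟩
  -- the companion `[dom r, γ·√(e x² + f x + g)]`, in the Baker sector by `sqrtDescent_holds`
  have hcomp : ∀ γ : ℚ, ∃ r₁ : KZ.IntegralRep 1, r₁.domain = r.domain ∧
      (r₁.integrand = fun v => (γ : ℝ) * √(qD e f g (v 0))) ∧ InBaker (KZ.of r₁) := by
    intro γ
    refine ⟨bddRep r.domain r.isSemialgebraic_domain hb (fun v => (γ : ℝ) * √(qD e f g (v 0)))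
      (((isSemialgebraicFunOn_ratCast r.isSemialgebraic_domain γ).mul_holds
        (isSemialgebraicFunOn_qD e f g r.isSemialgebraic_domain).sqrt_holds).congr fun _ _ => rfl)
      (|(γ : ℝ)| * √(|(e : ℝ)| + |(f : ℝ)| + |(g : ℝ)|)) fun v hv => ?_, rfl, rfl,
      sqrtDescent_holds e f g γ _ fun _ _ => rfl⟩
    rw [abs_mul]
    exact mul_le_mul_of_nonneg_left (abs_sqrt_qD_le e f g (hx v hv).1 (hx v hv).2) (abs_nonneg _)
  by_cases he : e = 0
  · subst he
    by_cases hf : f = 0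
    · subst hf
      obtain ⟨r₁, hd, hi, h₁⟩ := hcomp n0
      refine InBaker.of_sub' r r₁ hd h₁ (sqrtDescent_holds g 0 0 n1 _ fun v hv => ?_)
      have hv : v ∈ r.domain := hv
      rw [subRep_integrand, hi, hr hv]
      simp only [qD, Rat.cast_zero, zero_mul, zero_add, add_zero]
      rw [Real.sqrt_mul' _ (sq_nonneg _), Real.sqrt_sq (hx v hv).1]
      ring
    · exact InBaker.linear_factor f g hf (Polynomial.C n0 + Polynomial.C n1 * Polynomial.X) 1 r
        (fun v _ => by simp) fun v hv => by rw [hr hv]; simp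
  · obtain ⟨r₁, hd, hi, h₁⟩ := hcomp (n0 + n1 * (-f / (2 * e)))
    refine InBaker.of_sub' r r₁ hd h₁ (InBaker.odd_factor e f g he (Polynomial.C n1) 1 _
      (fun v _ => by simp) fun v hv => ?_)
    have hv : v ∈ r.domain := hv
    rw [subRep_integrand, hi, hr hv]
    simp only [Polynomial.aeval_C, eq_ratCast, map_one, div_one]
    push_cast
    ring

/-! #### 26.2 Sections of the affine potential `Φ = (a + b x) y + (c/2) y²` along a conic root -/

/-- If `c₀ + c₁ x + c₂ x²` vanishes at every real `x` then `c₀ = c₁ = c₂ = 0`. [folklore] -/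
theorem quad_coeffs_eq_zero (c0 c1 c2 : ℚ) (h : ∀ x : ℝ, (c0 : ℝ) + c1 * x + c2 * x ^ 2 = 0) :
    c0 = 0 ∧ c1 = 0 ∧ c2 = 0 := by
  have h0 := h 0
  have h1 := h 1
  have h2 := h (-1)
  have e0 : (c0 : ℝ) = 0 := by linarith
  have e1 : (c1 : ℝ) = 0 := by linarith
  have e2 : (c2 : ℝ) = 0 := by linarith
  exact ⟨by exact_mod_cast e0, by exact_mod_cast e1, by exact_mod_cast e2⟩

namespace Conic

variable (Q : Conic)

/-- The polynomial part `P₁(x) = −(a + b x) B/(2A) + c (B² + D)/(8A²)` of `Φ(x, root)`. -/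
def secP (a b c : ℚ) : MvPolynomial (Fin 1) ℚ :=
  -(C a + C b * X 0) * Q.Bp * C (1 / (2 * Q.A)) + C (c / (8 * Q.A ^ 2)) * (Q.Bp ^ 2 + Q.Dp)

/-- Evaluation of `secP`. [this node] -/
theorem aeval_secP (a b c : ℚ) (v : Fin 1 → ℝ) :
    aeval v (Q.secP a b c) = -((a : ℝ) + b * v 0) * Q.Bx (v 0) * (1 / (2 * Q.A)) +
      (c : ℝ) / (8 * Q.A ^ 2) * (Q.Bx (v 0) ^ 2 + Q.Dx (v 0)) := by
  simp only [secP, map_add, map_mul, map_neg, map_pow, MvPolynomial.aeval_C, MvPolynomial.aeval_X,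
    aeval_Bp, aeval_Dp, eq_ratCast]
  push_cast
  ring

/-- **ROOT VALUE IDENTITY.**  For `y = (−B + s u)/(2A)` with `s² = 1`, `u² = D`:
`(a + b x) y + (c/2) y² = [−(a + b x) B/(2A) + c (B² + D)/(8A²)] + [(a + b x)/(2A) − c B/(4A²)]·(s u)`.
[folklore] -/
theorem root_value (A B D a b c x s u : ℝ) (hs : s * s = 1) (hu : u ^ 2 = D) :
    (a + b * x) * ((-B + s * u) / (2 * A)) + c / 2 * ((-B + s * u) / (2 * A)) ^ 2 =
      (-(a + b * x) * B * (1 / (2 * A)) + c / (8 * A ^ 2) * (B ^ 2 + D)) +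
        ((a + b * x) / (2 * A) - c * B / (4 * A ^ 2)) * (s * u) := by
  linear_combination (c * u ^ 2 / (8 * A ^ 2)) * hs + (c / (8 * A ^ 2)) * hu

end Conic

/-- **ROOT PIECE.**  On `T ⊆ [0,1]` with `ζ = (−B + s√D)/(2A)` (`s = ±1`, `D ≥ 0`, `A ≠ 0`):
`[T, (a + b x) ζ + (c/2) ζ²] = [T, P₁] + [T, N·(s√D)]`, `deg N ≤ 1` — polynomial part by rule (1),
square-root part by `InBaker.affine_sqrt` (with Lean's `x / 0 = 0` the hypothesis `A ≠ 0` is not even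
needed). [this node] -/
theorem InBaker.conic_root_piece (Q : Conic) (a b c s : ℚ) (hs : s * s = 1)
    (r : KZ.IntegralRep 1) (hI : r.domain ⊆ Icc 0 1) (ζ : (Fin 1 → ℝ) → ℝ)
    (hD : ∀ v ∈ r.domain, 0 ≤ Q.Dx (v 0))
    (hζ : ∀ v ∈ r.domain, ζ v = (-Q.Bx (v 0) + s * √(Q.Dx (v 0))) / (2 * Q.A))
    (hr : EqOn r.integrand (fun v => ((a : ℝ) + b * v 0) * ζ v + (c : ℝ) / 2 * ζ v ^ 2) r.domain) :
    InBaker (KZ.of r) := by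
  refine InBaker.of_sub' r (polyRep₁ r.domain r.isSemialgebraic_domain hI (Q.secP a b c)) rfl
    (InBaker.of_eqOn_aeval _ (Q.secP a b c) fun v _ => rfl) ?_
  refine InBaker.affine_sqrt Q.e Q.f Q.g (s * (a / (2 * Q.A) - c * Q.b0 / (4 * Q.A ^ 2)))
    (s * (b / (2 * Q.A) - c * Q.b1 / (4 * Q.A ^ 2))) _ hI fun v hv => ?_
  have hv : v ∈ r.domain := hv
  have hu : √(Q.Dx (v 0)) ^ 2 = Q.Dx (v 0) := Real.sq_sqrt (hD v hv)
  have hs' : (s : ℝ) * s = 1 := by exact_mod_cast hs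
  rw [subRep_integrand, polyRep₁_integrand, hr hv]
  beta_reduce
  rw [hζ v hv, qD, ← Q.Dx_eq, Q.aeval_secP, Conic.root_value _ _ _ _ _ _ _ _ _ hs' hu]
  simp only [Conic.Bx]
  push_cast
  ring

/-- **CONIC SECTION LEMMA.**  Let `Q` be a conic over `ℚ`, not identically zero, `T ⊆ [0,1]`
`ℚ`-semialgebraic and `ζ : T → ℝ` `ℚ`-semialgebraic with `Q(x, ζ x) = 0` on `T`.  Then
`[T, (a + b x)·ζ + (c/2)·ζ²]` lies in the Baker sector: `A ≠ 0` — `ζ ∈ {(−B ± √D)/(2A)}` pointwise,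
split `T` by the branch and apply `InBaker.conic_root_piece`; `A = 0` — on `{B ≠ 0}` `ζ = −C/B` and the
integrand is a rational function (rule (1)), `{B = 0} ∩ T` is null unless `B ≡ 0`, in which case
`{C = 0} ∩ T` is null unless `C ≡ 0`, excluded. [KontsevichZagier2001 §1.2; this node] -/
theorem InBaker.conic_section (Q : Conic) (hQ : ∃ x y : ℝ, Q.pxy x y ≠ 0) (a b c : ℚ)
    (r : KZ.IntegralRep 1) (hI : r.domain ⊆ Icc 0 1) (ζ : (Fin 1 → ℝ) → ℝ)
    (hζ : IsSemialgebraicFunOn ℚ r.domain ζ) (hroot : ∀ v ∈ r.domain, Q.pxy (v 0) (ζ v) = 0)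
    (hr : EqOn r.integrand (fun v => ((a : ℝ) + b * v 0) * ζ v + (c : ℝ) / 2 * ζ v ^ 2) r.domain) :
    InBaker (KZ.of r) := by
  classical
  by_cases hA : Q.A = 0
  · -- `p = B(x) y + C(x)`
    have hA' : (Q.A : ℝ) = 0 := by exact_mod_cast hA
    refine InBaker.of_cover r ![{v | aeval v Q.Bp ≠ 0}, {v | aeval v Q.Bp = 0}] ?_ ?_ ?_
    · intro i
      fin_cases i
      · exact isSemialgebraic_setOf_eval_ne_zero _
      · exact isSemialgebraic_setOf_eval_eq_zero _
    · intro v _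
      by_cases h : aeval v Q.Bp = 0
      · exact mem_iUnion.2 ⟨1, h⟩
      · exact mem_iUnion.2 ⟨0, h⟩
    · intro i T hT hTr hTA
      fin_cases i
      · -- `B ≠ 0` on `T`: rational integrand
        refine InBaker.of_eqOn_aeval_div _
          (-(C a + C b * X 0) * Q.Cp * Q.Bp + C (c / 2) * Q.Cp ^ 2) (Q.Bp ^ 2)
          (fun v hv => by simpa using (hTA hv : aeval v Q.Bp ≠ 0)) fun v hv => ?_
        have hB : Q.Bx (v 0) ≠ 0 := by simpa [Q.aeval_Bp] using (hTA hv : aeval v Q.Bp ≠ 0)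
        have hz : ζ v = -Q.Cx (v 0) / Q.Bx (v 0) := by
          have h := hroot v (hTr hv)
          simp only [Conic.pxy, hA', zero_mul, zero_add] at h
          field_simp
          linarith
        rw [KZ.IntegralRep.integrand_restrict, hr (hTr hv)]
        beta_reduce
        rw [hz]
        simp only [map_add, map_mul, map_neg, map_pow, MvPolynomial.aeval_C, MvPolynomial.aeval_X,
          Q.aeval_Bp, Q.aeval_Cp, eq_ratCast]
        push_cast
        field_simp
      · -- `B = 0` on `T`, hence `C = 0` on `T`
        have hB : ∀ v ∈ T, Q.Bx (v 0) = 0 := fun v hv => by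
          simpa [Q.aeval_Bp] using (hTA hv : aeval v Q.Bp = 0)
        have hC : ∀ v ∈ T, Q.Cx (v 0) = 0 := fun v hv => by
          have h := hroot v (hTr hv)
          simp only [Conic.pxy, hA', zero_mul, zero_add, hB v hv] at h
          exact h
        by_cases hb : Q.b0 = 0 ∧ Q.b1 = 0
        · by_cases hc : Q.c0 = 0 ∧ Q.c1 = 0 ∧ Q.c2 = 0
          · exfalso
            obtain ⟨x, y, hxy⟩ := hQ
            apply hxy
            simp [Conic.pxy, Conic.Bx, Conic.Cx, hA, hb.1, hb.2, hc.1, hc.2.1, hc.2.2]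
          · refine InBaker.of_subset_zeroSet _ Q.Cp ?_ fun v hv => by simpa [Q.aeval_Cp] using hC v hv
            by_contra hall
            exact hc (quad_coeffs_eq_zero _ _ _ fun x => by
              simpa [Q.aeval_Cp, Conic.Cx] using not_not.1 (not_exists.1 hall fun _ => x))
        · refine InBaker.of_subset_zeroSet _ Q.Bp ?_ fun v hv => (hTA hv : aeval v Q.Bp = 0)
          by_contra hall
          have h := quad_coeffs_eq_zero Q.b0 Q.b1 0 fun x => by
            simpa [Q.aeval_Bp, Conic.Bx] using not_not.1 (not_exists.1 hall fun _ => x)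
          exact hb ⟨h.1, h.2.1⟩
  · -- `A ≠ 0`: `ζ` is one of the two roots
    have hrt : ∀ v ∈ r.domain, 0 ≤ Q.Dx (v 0) ∧ (ζ v = Q.lox (v 0) ∨ ζ v = Q.hix (v 0)) :=
      fun v hv => Q.eq_root_of_eq_zero hA _ _ (hroot v hv)
    refine InBaker.of_cover r ![{v | v ∈ r.domain ∧ ζ v = Q.lox (v 0)},
      {v | v ∈ r.domain ∧ ζ v = Q.hix (v 0)}] ?_ ?_ ?_
    · intro i
      fin_cases i
      · exact isSemialgebraic_sep_eq hζ (Q.isSemialgebraicFunOn_lox r.isSemialgebraic_domain)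
      · exact isSemialgebraic_sep_eq hζ (Q.isSemialgebraicFunOn_hix r.isSemialgebraic_domain)
    · intro v hv
      rcases (hrt v hv).2 with h | h
      · exact mem_iUnion.2 ⟨0, hv, h⟩
      · exact mem_iUnion.2 ⟨1, hv, h⟩
    · intro i T hT hTr hTA
      fin_cases i
      · refine InBaker.conic_root_piece Q a b c 1 (by norm_num) _ (fun v hv => hI (hTr hv)) ζ
          (fun v hv => (hrt v (hTr hv)).1) (fun v hv => ?_) fun v hv => hr (hTr hv)
        have h : ζ v = Q.lox (v 0) := (hTA hv : v ∈ r.domain ∧ ζ v = Q.lox (v 0)).2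
        rw [h, Conic.lox]; push_cast; ring
      · refine InBaker.conic_root_piece Q a b c (-1) (by norm_num) _ (fun v hv => hI (hTr hv)) ζ
          (fun v hv => (hrt v (hTr hv)).1) (fun v hv => ?_) fun v hv => hr (hTr hv)
        have h : ζ v = Q.hix (v 0) := (hTA hv : v ∈ r.domain ∧ ζ v = Q.hix (v 0)).2
        rw [h, Conic.hix]; push_cast; ring

end Summit.KontsevichZagierPeriods.RootDecompWalshStrata.ConicDescent
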